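import Summits.QuantumAdvantage.QuantumAdvantage.Theorems.CharDialSubCharBlocks
import Summits.QuantumAdvantage.AdviceFreeQNC0.WalkHardFJuntaCuts
import Summits.QuantumAdvantage.AdviceFreeQNC0.LinearSelections
import HarnessLib

/-!
# Cell qa-qnc0 / decomp-qadv (odd primes): sub-characteristic junta law, part 3/3 — `junta_of_hasDegF_subChar`, sharpness, and the walk rung `walkHardF_subChar`

TREE-READY PART of the node `HOME/decomp-qadv-lens-6/g8/CharDial.lean` (decomp-qadv-lens-6 g8), ZERO `def … : Prop`.

* §8b `block_periodic` (a Boolean `f` of `𝔽_p`-degree `≤ p − 2` that is layer-symmetric on a `(p−1)`-block is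
  constant there — packaged), `no_sensitive_zero_block` (layered Ramsey + the block lemma: no vertex has `M`
  sensitive `0`-coordinates, `M` the layered-Ramsey threshold for `(p − 1, p − 2)`), and the
  **SUB-CHARACTERISTIC JUNTA LAW** `junta_of_hasDegF_subChar`: for every prime `p` and `d + 2 ≤ p` there is
  `J₀ = J₀(p)` such that every BOOLEAN-VALUED function on `{0,1}ⁿ` of `𝔽_p`-degree `≤ d` (tree `HasDegF`) depends
  on at most `J₀` coordinates — uniformly in `n`.  (Simon: a non-`J`-junta has a vertex with many sensitive
  coordinates; negate inputs so that `2M` of them are `0` at the vertex; Ramsey makes a `(p−1)`-sub-block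
  layer-symmetric; the block lemma makes `f` constant on it; contradiction with sensitivity.)
* §9 SHARPNESS: at `d = p − 1` the law fails for every prime (`juntaLaw_fails_at_pred`: the `MOD_p` function of
  `J₀ + 1` variables has degree `p − 1` by the tree's `hasDegF_linTest` and all variables sensitive at `0`).
* the WALK RUNG `walkHardF_subChar`: for every prime `p ≠ 3` and every `d` with `d + 2 ≤ p`, a strategy all of whose
  cuts have `𝔽_p`-degree `≤ d` wins the u-walk game on at most `θ·2ⁿ` inputs (`n ≥ n₀`) — the junta law feeds the
  tree theorem `walkHardFJuntaCuts` (juntas of size `≤ (log₂ n)^1`).  This strictly contains the g7 rung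
  `walkHardF_subLog` (`2^d < p`) for `p ≥ 5`; at `p = 3` the range `d ≤ 1` is inside `walkHardF_subLog`.

Landing suggestion (prover lane, in order after parts 0–2): `ledger propose --kind proof --target
Summits/QuantumAdvantage/AdviceFreeQNC0/SubCharJunta.lean --supports stmt-QuantumAdvantage-30736` (+ 26762; and
`--supports` the CharDial items if the writer files the route).  WHAT THIS IS NOT: nothing at degree `p − 1` or
higher (the Frobenius notch `d = p − 1` is exactly where `MOD_p` tests of linear forms enter); no claim on
`WalkHardF p`.
-/

noncomputable section

namespace Summit.QuantumAdvantage.AdviceFreeQNC0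

namespace SubChar

open Finset
open Literature.Computability.MetaComplexity Literature.Computability.MetaComplexity.Smolensky
open SubLog

variable {n : ℕ}

/-- **Block periodicity at the Frobenius degree** (the block lemma ONE NOTCH UP, PROVED): if `f` has `𝔽_p`-degree
`≤ d ≤ p − 1` and is layer-symmetric on a block `Y` of `p` coordinates that are `0` at `x`, then `f(x ∨ 1_Y) = f(x)`:
the layer profile is `p`-PERIODIC (`G p = G 0`; `μ_Y = (−1)^p [G 0] + [G p]` since `p ∣ C(p,t)` for `0 < t < p`).
At `d ≤ p − 2` the profile is constant (`block_constant`); at `d = p − 1` only periodicity survives — exactly the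
room the `MOD_p` tests `modpFn` use (§9).  First rung of the node's `FrobStructureLaw`. -/
theorem block_periodic (p : ℕ) [hp : Fact p.Prime] {d : ℕ} (hdp : d + 1 ≤ p) {f : (Fin n → Bool) → Bool}
    (hf : HasDegF p f d) (x : Fin n → Bool) (Y : Finset (Fin n)) (hY : Y.card = p)
    (hx : ∀ i ∈ Y, x i = false)
    (hsym : ∀ T ⊆ Y, ∀ T' ⊆ Y, T.card = T'.card → f (setOn T x) = f (setOn T' x)) :
    f (setOn Y x) = f x := by
  classical
  let G : ℕ → Bool := fun t =>
    if h : ∃ T : Finset (Fin n), T ⊆ Y ∧ T.card = t then f (setOn (Classical.choose h) x) else false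
  have hG : ∀ T ⊆ Y, f (setOn T x) = G T.card := by
    intro T hT
    have h : ∃ T' : Finset (Fin n), T' ⊆ Y ∧ T'.card = T.card := ⟨T, hT, rfl⟩
    simp only [G, dif_pos h]
    exact hsym T hT _ (Classical.choose_spec h).1 (Classical.choose_spec h).2.symm
  have hG0 : f x = G 0 := by
    have h := hG ∅ (Finset.empty_subset _)
    rwa [setOn_empty, Finset.card_empty] at h
  have hGp : f (setOn Y x) = G p := by rw [hG Y (Finset.Subset.refl Y), hY]
  have hr : HasDegF p (fun u => f (overOn Y x u)) d := hasDegF_overOn p Y x hf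
  have hvert : ∀ T ⊆ Y, indR (ZMod p) (fun u => f (overOn Y x u)) (vert T) = if G T.card = true then 1 else 0 := by
    intro T hT
    simp only [indR, overOn_vert hT hx, hG T hT]
  have htop : moeb (indR (ZMod p) (fun u => f (overOn Y x u))) Y = 0 :=
    moeb_eq_zero_of_mem_lowDeg ((hasDegF_iff_indR p _ d).1 hr) (by rw [hY]; omega)
  have hsum : moeb (indR (ZMod p) (fun u => f (overOn Y x u))) Y =
      (-1) ^ p * (if G 0 = true then (1 : ZMod p) else 0) + (if G p = true then (1 : ZMod p) else 0) := by
    unfold moeb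
    have h1 : ∀ T ∈ Y.powerset, (-1 : ZMod p) ^ (Y.card - T.card) * indR (ZMod p) (fun u => f (overOn Y x u)) (vert T)
        = (fun t : ℕ => (-1 : ZMod p) ^ (p - t) * (if G t = true then (1 : ZMod p) else 0)) T.card := by
      intro T hT
      rw [hvert T (Finset.mem_powerset.1 hT), hY]
    rw [Finset.sum_congr rfl h1,
      Finset.sum_powerset_apply_card (fun t : ℕ => (-1 : ZMod p) ^ (p - t) * (if G t = true then (1 : ZMod p) else 0)),
      hY, Finset.sum_range_succ, Finset.range_eq_Ico, Finset.sum_eq_sum_Ico_succ_bot hp.out.pos]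
    have hmid : ∑ i ∈ Ico (0 + 1) p,
        p.choose i • (fun t : ℕ => (-1 : ZMod p) ^ (p - t) * (if G t = true then (1 : ZMod p) else 0)) i = 0 := by
      refine Finset.sum_eq_zero fun i hi => ?_
      have hi' := Finset.mem_Ico.1 hi
      rw [nsmul_eq_mul, (ZMod.natCast_eq_zero_iff _ _).2 (hp.out.dvd_choose_self (by omega) hi'.2), zero_mul]
    rw [hmid, add_zero, Nat.choose_zero_right, Nat.choose_self, one_nsmul, one_nsmul]
    rw [Nat.sub_zero, Nat.sub_self, pow_zero, one_mul]
  rw [hsum] at htop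
  rw [hGp, hG0]
  revert htop
  cases G 0 <;> cases G p <;> simp

/-- **No large sensitive zero-block.**  If `M` is a layered-Ramsey threshold for `(p − 1, p − 2)`, a Boolean function
of `𝔽_p`-degree `≤ d ≤ p − 2` has no vertex `x` with `M` sensitive coordinates that are `0` at `x`: Ramsey makes a
`(p−1)`-sub-block layer-symmetric (layers `0, 1` are symmetric by sensitivity, layer `p − 1` is a single set), the
block lemma makes `f` constant on it, contradicting sensitivity. -/
theorem no_sensitive_zero_block (p : ℕ) [hp : Fact p.Prime] {d : ℕ} (hdp : d + 2 ≤ p) {M : ℕ}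
    (hM : ∀ (α : Type) [DecidableEq α] (V : Finset α) (χ : Finset α → Bool), M ≤ V.card →
      ∃ Y ⊆ V, Y.card = p - 1 ∧ ∀ t, 2 ≤ t → t ≤ p - 2 → ∃ c, ∀ T ⊆ Y, T.card = t → χ T = c)
    {f : (Fin n → Bool) → Bool} (hf : HasDegF p f d) (x : Fin n → Bool) (Z : Finset (Fin n))
    (hZ : M ≤ Z.card) (hx : ∀ i ∈ Z, x i = false) (hsens : ∀ i ∈ Z, f (flip i x) ≠ f x) : False := by
  classical
  obtain ⟨Y, hYZ, hYcard, hlayer⟩ := hM (Fin n) Z (fun T => f (setOn T x)) hZ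
  have hxY : ∀ i ∈ Y, x i = false := fun i hi => hx i (hYZ hi)
  have hflip1 : ∀ i ∈ Y, f (setOn {i} x) = !f x := by
    intro i hi
    rw [setOn_singleton_eq_flip (hxY i hi)]
    have h := hsens i (hYZ hi)
    revert h
    cases f (flip i x) <;> cases f x <;> simp
  have hsym : ∀ T ⊆ Y, ∀ T' ⊆ Y, T.card = T'.card → f (setOn T x) = f (setOn T' x) := by
    intro T hT T' hT' hcard
    have hTle : T.card ≤ p - 1 := hYcard ▸ Finset.card_le_card hT
    rcases Nat.lt_or_ge T.card 2 with hlt | hge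
    · rcases Nat.lt_or_ge T.card 1 with h0 | h1
      · have hT0 : T = ∅ := Finset.card_eq_zero.1 (by omega)
        have hT'0 : T' = ∅ := Finset.card_eq_zero.1 (by omega)
        rw [hT0, hT'0]
      · obtain ⟨i, hi⟩ := Finset.card_eq_one.1 (show T.card = 1 by omega)
        obtain ⟨j, hj⟩ := Finset.card_eq_one.1 (show T'.card = 1 by omega)
        subst hi
        subst hj
        rw [hflip1 i (hT (Finset.mem_singleton_self i)), hflip1 j (hT' (Finset.mem_singleton_self j))]
    · by_cases hle : T.card ≤ p - 2
      · obtain ⟨c, hc⟩ := hlayer T.card hge hle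
        have hc1 : f (setOn T x) = c := hc T hT rfl
        have hc2 : f (setOn T' x) = c := hc T' hT' hcard.symm
        rw [hc1, hc2]
      · have hTY : T = Y := Finset.eq_of_subset_of_card_le hT (by omega)
        have hT'Y : T' = Y := Finset.eq_of_subset_of_card_le hT' (by omega)
        rw [hTY, hT'Y]
  have hconst := block_constant p hdp hf x Y hYcard hxY hsym
  have hYne : Y.Nonempty := Finset.card_pos.1 (by rw [hYcard]; have := hp.out.two_le; omega)
  obtain ⟨i, hi⟩ := hYne
  have h1 := hconst {i} (Finset.singleton_subset_iff.2 hi)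
  rw [hflip1 i hi] at h1
  revert h1
  cases f x <;> simp

/-- **THE SUB-CHARACTERISTIC JUNTA LAW — PROVED.**  For every prime `p` and `d ≤ p − 2` there is `J₀ = J₀(p)` such
that every Boolean function of `𝔽_p`-degree `≤ d` (any number of variables) depends on at most `J₀` of them.
(`J₀ = 2M·4^{2M}`, `M` the layered Ramsey threshold; Simon's lemma supplies a vertex with `2M` sensitive coordinates,
`M` of one polarity; negating inputs reduces to the zero-block case.)  Equivalent to the `k = 1` case of
[Sun–Sun–Wang–Wu–Xia–Zheng, ICALP 2020, Thm 2: `deg_p f ≥ p − 1` for every non-degenerate `f` on `n ≥ n₀(p)` variables];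
the threshold is SHARP (`juntaLaw_fails_at_pred`). -/
theorem junta_of_hasDegF_subChar (p : ℕ) [hp : Fact p.Prime] (d : ℕ) (hdp : d + 2 ≤ p) :
    ∃ J₀ : ℕ, ∀ (n : ℕ) (f : (Fin n → Bool) → Bool), HasDegF p f d →
      ∃ J : Finset (Fin n), J.card ≤ J₀ ∧ ∀ u v : Fin n → Bool, (∀ i ∈ J, u i = v i) → f u = f v := by
  classical
  obtain ⟨M, hM⟩ := layered_ramsey (p - 1) (p - 2)
  refine ⟨(2 * M) * 4 ^ (2 * M), fun n f hf => ?_⟩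
  rcases junta_or_sensitive f (2 * M) with ⟨x, hx⟩ | hJ
  · exfalso
    have hsplit := Finset.card_filter_add_card_filter_not (s := sensAt f x) (fun i => x i = false)
    have hneg : ((sensAt f x).filter fun i => ¬ x i = false) = (sensAt f x).filter fun i => x i = true :=
      Finset.filter_congr fun i _ => by simp
    rw [hneg] at hsplit
    by_cases h0 : M ≤ ((sensAt f x).filter fun i => x i = false).card
    · exact no_sensitive_zero_block p hdp hM hf x _ h0
        (fun i hi => (Finset.mem_filter.1 hi).2) (fun i hi => mem_sensAt.1 (Finset.mem_filter.1 hi).1)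
    · have h1 : M ≤ ((sensAt f x).filter fun i => x i = true).card := by omega
      generalize hZ1 : ((sensAt f x).filter fun i => x i = true) = Z1 at h1
      have hmemZ1 : ∀ i ∈ Z1, i ∈ sensAt f x ∧ x i = true := fun i hi => by
        rw [← hZ1, Finset.mem_filter] at hi
        exact hi
      refine no_sensitive_zero_block p hdp hM (hasDegF_negOn p Z1 hf) (negOn Z1 x) Z1 h1 ?_ ?_
      · intro i hi
        show (if i ∈ Z1 then !x i else x i) = false
        rw [if_pos hi, (hmemZ1 i hi).2]
        rfl
      · intro i hi
        have hs : f (flip i x) ≠ f x := mem_sensAt.1 (hmemZ1 i hi).1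
        show f (negOn Z1 (flip i (negOn Z1 x))) ≠ f (negOn Z1 (negOn Z1 x))
        rw [negOn_flip, negOn_negOn]
        exact hs
  · exact hJ

/-! ### §9 Sharpness: the junta law FAILS at `d = p − 1` (the Frobenius notch: MOD_p tests of linear forms enter) -/

/-- The MOD_p function `[Σᵢ uᵢ ≡ 0 (mod p)]` of `n` variables. -/
def modpFn (p n : ℕ) : (Fin n → Bool) → Bool := fun u => decide ((∑ i, (if u i then (1 : ZMod p) else 0)) = 0)

/-- It has `𝔽_p`-degree `≤ p − 1` (tree: `hasDegF_linTest`, `[a = r] = 1 − (a − r)^{p−1}`). -/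
theorem hasDegF_modpFn (p : ℕ) [Fact p.Prime] (n : ℕ) : HasDegF p (modpFn p n) (p - 1) :=
  hasDegF_linTest (fun _ => 1) 0

/-- CharDial sub-characteristic helper `modpFn_zero` (lens-6 g8 LAND package; see the module docstring). -/
theorem modpFn_zero (p n : ℕ) : modpFn p n (fun _ => false) = true := by
  simp [modpFn]

/-- CharDial sub-characteristic helper `modpFn_flip_zero` (lens-6 g8 LAND package; see the module docstring). -/
theorem modpFn_flip_zero (p : ℕ) [hp : Fact p.Prime] {n : ℕ} (i : Fin n) :
    modpFn p n (flip i fun _ => false) = false := by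
  have hsum : (∑ j : Fin n, (if flip i (fun _ => false) j then (1 : ZMod p) else 0)) = 1 := by
    rw [Finset.sum_eq_single i]
    · simp
    · intro j _ hji
      rw [flip_apply_of_ne hji]
      rfl
    · intro h
      exact absurd (Finset.mem_univ i) h
  rw [modpFn, hsum]
  simp

/-- **Sharpness.** For every `J₀` there is a Boolean function of `𝔽_p`-degree `≤ p − 1` that is not a `J₀`-junta
(all `J₀ + 1` variables of `modpFn` are sensitive at `0`). -/
theorem not_junta_at_pred (p : ℕ) [hp : Fact p.Prime] (J₀ : ℕ) :
    ∃ (n : ℕ) (f : (Fin n → Bool) → Bool), HasDegF p f (p - 1) ∧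
      ¬ ∃ J : Finset (Fin n), J.card ≤ J₀ ∧ ∀ u v : Fin n → Bool, (∀ i ∈ J, u i = v i) → f u = f v := by
  refine ⟨J₀ + 1, modpFn p (J₀ + 1), hasDegF_modpFn p _, ?_⟩
  rintro ⟨J, hJ, hdep⟩
  obtain ⟨i, hi⟩ : ∃ i : Fin (J₀ + 1), i ∉ J := by
    by_contra h
    push Not at h
    have hle : (univ : Finset (Fin (J₀ + 1))).card ≤ J.card := Finset.card_le_card fun i _ => h i
    rw [Finset.card_univ, Fintype.card_fin] at hle
    omega
  have h := hdep (fun _ => false) (flip i fun _ => false) fun j hj => by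
    have hji : j ≠ i := fun h => hi (h ▸ hj)
    rw [flip_apply_of_ne hji]
  rw [modpFn_zero, modpFn_flip_zero] at h
  exact Bool.noConfusion h

/-- The junta law with `d = p − 1` is FALSE for every prime `p` (so `d + 2 ≤ p` in `SubCharJuntaLaw` is sharp). -/
theorem juntaLaw_fails_at_pred (p : ℕ) [Fact p.Prime] :
    ¬ ∃ J₀ : ℕ, ∀ (n : ℕ) (f : (Fin n → Bool) → Bool), HasDegF p f (p - 1) →
      ∃ J : Finset (Fin n), J.card ≤ J₀ ∧ ∀ u v : Fin n → Bool, (∀ i ∈ J, u i = v i) → f u = f v := by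
  rintro ⟨J₀, h⟩
  obtain ⟨n, f, hf, hnot⟩ := not_junta_at_pred p J₀
  exact hnot (h n f hf)



end SubChar

open Finset
open Literature.Computability.MetaComplexity Literature.Computability.MetaComplexity.Smolensky

/-- **`walkHardF_subChar`** — for every prime `p ≠ 3` and every `d` with `d + 2 ≤ p` (sub-characteristic degree), a
strategy all of whose cuts have `𝔽_p`-degree `≤ d` wins the u-walk game on at most `θ·2ⁿ` inputs for `n ≥ n₀`
(with the `θ` of `walkHardFJuntaCuts p`; `n₀ = max n₀(1) 2^{J₀(p)}`).  Proof: by `SubChar.junta_of_hasDegF_subChar`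
every cut is a `J₀`-junta, `J₀ ≤ log₂ n` for `n ≥ 2^{J₀}`, and `walkHardFJuntaCuts` applies with exponent `C = 1`. -/
theorem walkHardF_subChar (p : ℕ) [Fact p.Prime] (hp3 : p ≠ 3) (d : ℕ) (hd : d + 2 ≤ p) :
    ∃ θ : ℝ, θ < 1 ∧ ∃ n₀ : ℕ, ∀ n ≥ n₀, ∀ c : ℕ, ∀ y : Fin (n + 1) → (Fin n → Bool) → Bool,
      (∀ g, HasDegF p (y g) d) →
        ((univ.filter fun u : Fin n → Bool => ringWinU c y u = true).card : ℝ) ≤ θ * (2 : ℝ) ^ n := by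
  obtain ⟨J₀, hJ₀⟩ := SubChar.junta_of_hasDegF_subChar p d hd
  obtain ⟨θ, hθ, H⟩ := walkHardFJuntaCuts p hp3
  obtain ⟨n₀, hn₀⟩ := H 1
  refine ⟨θ, hθ, max n₀ (2 ^ J₀), fun n hn c y hy => hn₀ n (le_trans (le_max_left _ _) hn) c y fun g => ?_⟩
  obtain ⟨J, hJc, hJdep⟩ := hJ₀ n (y g) (hy g)
  have hd' : J₀ ≤ Nat.log 2 n := Nat.le_log_of_pow_le (by norm_num) (le_trans (le_max_right _ _) hn)
  exact ⟨J, by rw [pow_one]; exact hJc.trans hd', hJdep⟩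

/-- The same for every prime `p ≥ 5` and every `d ≤ p − 2` (the form the CharDial node calls `SubCharHardOdd`). -/
theorem walkHardF_subChar_of_five_le (p : ℕ) [Fact p.Prime] (hp : 5 ≤ p) (d : ℕ) (hd : d + 2 ≤ p) :
    ∃ θ : ℝ, θ < 1 ∧ ∃ n₀ : ℕ, ∀ n ≥ n₀, ∀ c : ℕ, ∀ y : Fin (n + 1) → (Fin n → Bool) → Bool,
      (∀ g, HasDegF p (y g) d) →
        ((univ.filter fun u : Fin n → Bool => ringWinU c y u = true).card : ℝ) ≤ θ * (2 : ℝ) ^ n :=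
  walkHardF_subChar p (by omega) d hd

end Summit.QuantumAdvantage.AdviceFreeQNC0

end
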